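import Summits.QuantumFields.YangMills.Theorems.BalabanUVNodesN18TwoRunRecord
import Literature.MathematicalPhysics.QuantumFieldTheory.Balaban1983to89.NodeOLetters

/-!
# BalabanUVNodes ∕ N18 — the END's per-term record binder FROM NODE O's LETTER INTERFACE for the TWO runs: letters
# (L1)–(L3) for each run's Γ-kernel and precision, (L4) + invertibility for run A's precision, two TWO-RUN CLOSENESS
# letters, and rows NE2∕NE3's rate — `N18TwoRunRecord.termWalkData_of_twoRuns_at_window` (T42 at a window scale) with its
# walk-level binders DISCHARGED BY NAME by `NodeOLetters` (Track A, DAG node N18 = NE5 `T4OutputRate.NE5 EA EB W κ θ C₅` :211;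
# cluster K4 «SpineRates»; in-edge NODE O ∕ W1 in its LETTER currency)

HONEST FRAMING.  Count-neutral kernel bookkeeping (seat pub-ymgap-dag-n18-a g5; `--supports stmt-QuantumFields-19182`): a
composition of LANDED hypothesis SHAPES — ym-nodeO-ideate's walk-free interface `NodeOLetters` (`KernelLetters`,
`jointWalkExpansion_of_letters`, two-term packaging) and g0's `termWalkData_of_twoRuns_at_window` (T42 + the junction
inequality).  Every letter is a HYPOTHESIS; nothing of Bałaban's `Γ_k`, `Δ^{(k)}(Z₀,σ,𝐔,𝐉)`, `C^{(k)}` is constructed or asserted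
(NODE O's instance is 0∕1, «reduced to letters»); NE5 NOT IN PRINT and NOT PROVED; NOT a node discharge; one finite
four-torus at fixed ε; nothing continuum ∕ ℝ⁴ ∕ OS ∕ mass-gap ∕ Clay.  THEOREMS ONLY: 0 `def`, 0 `sorry`, standard axioms.

THE POINT.  The END of row NE5 (`N18End.n18_family_of_end8`, binder at :128) wants, at every WINDOW scale `θ^j < s′` and per
(2.14)-term, ONE record `TermWalkData (𝒦 j Z t φ) (w j)` over the TWO-RUN PENCIL (u-slot = pencil parameter, radius
`(w j).R = max 2 (s′∕θ^j)·C_R`).  g0's file 4 met it from the two runs' WALK-LEVEL (v)⁺ witnesses — joint walk expansions of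
`GA, GB` ∕ `AA, AB` on common skeletons, termwise `r`-close, run A's covariance walk data, Neumann letters — under the rate
`r ≤ C₂θ^j`.  NODE O's interface is now typed WALK-FREE (`NodeOLetters`, cell ym-nodeO-ideate, 2026-08-25): letters (L1)
plain decay, (L2) σ-localisation through `X`, (L3) `u`-holomorphy ⟹ `JointWalkExpansion` with the TWO-TERM skeleton
`W = Bool` (`jointWalkExpansion_of_letters`); (L4) plain decay of the inverse precision ⟹ `WalkMajorants`
(`walkMajorants_of_decay`).  THIS FILE re-keys file 4's walk binders to that currency:
* §1 `termwise_close_of_letters` — two kernel families that are ENTRYWISE `r`-close on polydisc × ball (two-run letter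
  (C1)) and whose σ-localised pieces are `r`-close through `X` (two-run letter (C2)) have termwise `r`-close TWO-TERM
  skeletons (`twoTerms`, amplitudes `ampl`, distances `walkDist`) — file 4's `hdiffΓ` ∕ `hdiffE`;
  `domBy_walkDist` (file 4's `hEdom`), `domBy_tdist1`, `majSumLe_single` (file 4's `hCdom`, `hCms` for the ONE-TERM
  covariance family of (L4)).
* §2 **`termWalkData_of_twoRunLetters_at_window`** — the END's record binder `TermWalkData 𝒦 wj` at a window scale FROM:
  `KernelLetters` for `GA, GB, AA, AB` (common constants per slot), the two-run closeness letters (C1), (C2) per slot with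
  rows NE2∕NE3's `r ≤ C₂θ^j`, run A's (L4) `‖(AA σ u)⁻¹_{ik}‖ ≤ B_C e^{−ρ_C d₁}` + invertibility `AA(AA)⁻¹ = 1` (letter (C3);
  NODE A's positivity would supply it), the geometric clause (L5), and T42's NUMERIC side conditions VERBATIM (row sums, rate
  windows, the fibre bound `m`, the Neumann smallness `q < 1` with `K̄_E := 3B_E + B′_E`, `K̄_C := B_C`); letters to the END:
  `(1+s)(3B_Γ + B′_Γ)`, `(1+s)(3B_E + B′_E)`, `B_C(1−q)⁻¹`.  Proof: file 4 with `hΓA, hΓB, hEA, hEB` ≔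
  `jointWalkExpansion_of_letters`, `hdiffΓ, hdiffE` ≔ §1, (C) ≔ the one-term family `(_ : Unit) ↦ (AA σ u)⁻¹`.
* §3 (v1.1) `kernelLetters_of_static`, `close_of_static` — STATIC run kernels carry the letters at EVERY radius; §4 (v1.2)
  `termWalkData_of_staticLetters_at_window` — §2 for static families from σ-only letters (radius `:= wj.R`, fibre bound from
  the record field `𝒦.hfib` and `𝒦.m ≤ m`), the form consumed by `BalabanUVNodesN18EndLetters` («the END from letters»).
So N18's END binder is met BY NAME from: NODE O's letters for BOTH runs at the window scales (uniform), the two two-run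
closeness letters, run A's (L4) + invertibility, and the rate.  The CLOSENESS letters (C1)∕(C2) are the walk-free form of
King's «difference of propagators on one line» ([King1986] p. 665) and are rows NE2∕NE3's ∕ NODE O's OBJECT-level content —
NOT supplied here.
NOT COVERED: the letters for Bałaban's actual operators (NODE O 0∕1); run B's kernels are asked on the SAME ball radius `R`
as run A's and with the same constants (take maxima); the END's other binders (σ-holomorphy, symmetry, potentials…) are
untouched (they are not walk data).

Sources: T. Bałaban, CMP **116** (1988) [Balaban1988RG2Cluster] (1.5) p. 3, (1.11) p. 5, p. 13, p. 15, (2.16) p. 16;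
CMP **99** (1985) [Balaban1985BackgroundPropagators] (3.93) p. 410, Thm 3.10 p. 416, (3.130) p. 421; C. King, CMP **102**
(1986) [King1986] p. 665.  Nothing here is a claim about the Yang–Mills mass gap.
-/

noncomputable section

namespace Summit.QuantumFields.YangMills.BalabanUVNodes.N18TwoRunLetters

open Metric Set Matrix Finset
open Literature.MathematicalPhysics.QuantumFieldTheory.Balaban1983to89
open Literature.MathematicalPhysics.QuantumFieldTheory.Balaban1983to89.B9SectDWalk (MajSumLe DomBy)
open Literature.MathematicalPhysics.QuantumFieldTheory.Balaban1983to89.B9Thm34Ext (toB6 toB6_dist)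
open Literature.MathematicalPhysics.QuantumFieldTheory.Balaban1983to89.B9Thm37GlueTorus
  (torusGeom tdist1 tdist1_nonneg dist_torusGeom)
open Literature.MathematicalPhysics.QuantumFieldTheory.Balaban1983to89.TreeLengthTorus (TPt)
open Literature.MathematicalPhysics.QuantumFieldTheory.Balaban1983to89.B5TorusCover (UT)
open Literature.MathematicalPhysics.QuantumFieldTheory.Balaban1983to89.B11SectG (RowSum)
open Literature.MathematicalPhysics.QuantumFieldTheory.Balaban1983to89.B13TermWalkData (WalkConsts TermKernels TermWalkData)
open Literature.MathematicalPhysics.QuantumFieldTheory.Balaban1983to89.NodeOLetters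
  (KernelLetters twoTerms ampl walkDist distX twoTerms_false twoTerms_true ampl_false ampl_true walkDist_false walkDist_true
    tdist1_le_distX jointWalkExpansion_of_letters)
open Summit.QuantumFields.YangMills.BalabanUVNodes.N18TwoRunRecord (termWalkData_of_twoRuns_at_window)

variable {d N' : ℕ} {ν : ℕ} {Nf : Fin ν → ℕ} [∀ i, NeZero (Nf i)]

/-! ## §1 Two-run closeness letters ⟹ termwise closeness of the two-term skeletons; the one-term covariance family -/

section Letters

variable {p n : Type} {E : Type*} [NormedAddCommGroup E] {c : B13.Consts}

/-- **TERMWISE CLOSENESS FROM THE TWO-RUN CLOSENESS LETTERS.**  If two kernel families `K_A, K_B` are ENTRYWISE `r`-close on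
polydisc × ball, `‖K_B(σ,u)_{ij} − K_A(σ,u)_{ij}‖ ≤ r·B·e^{−ρ d₁(i,j)}` (letter (C1)), and their σ-localised pieces are `r`-close
THROUGH `X`, `‖(K_B(σ,0) − K_B(0,0))_{ij} − (K_A(σ,0) − K_A(0,0))_{ij}‖ ≤ r·B′·e^{−ρ d_X(i,j)}` (letter (C2)), then the TWO-TERM
skeletons of `NodeOLetters.jointWalkExpansion_of_letters` (σ-free term `K(σ,u) − K(σ,0) + K(0,0)`, σ-carrying term
`K(σ,0) − K(0,0)`) are termwise `r`-close with the run's own amplitudes and walk distances: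
`‖T_B(ω) − T_A(ω)‖ ≤ r·(ampl B B′ ω)·e^{−ρ·walkDist X ω}` — file 4's binder `hdiffΓ` ∕ `hdiffE`.
[cite: Balaban1988RG2Cluster, (1.11) p.5, (2.16) p.16; King1986, p.665] -/
theorem termwise_close_of_letters {locp : p → UT Nf} {locn : n → UT Nf}
    {KA KB : (TPt d N' → ℂ) → E → Matrix p n ℂ} {X : Finset (UT Nf)} {R ρ B B' r : ℝ}
    (hclose : ∀ σ : TPt d N' → ℂ, (∀ j, ‖σ j‖ ≤ Real.exp c.κ₁) → ∀ u ∈ ball (0 : E) R,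
      ∀ i j, ‖KB σ u i j - KA σ u i j‖ ≤ r * (B * Real.exp (-(ρ * tdist1 Nf (locp i) (locn j)))))
    (hlocClose : ∀ σ : TPt d N' → ℂ, (∀ j, ‖σ j‖ ≤ Real.exp c.κ₁) →
      ∀ i j, ‖(KB σ 0 i j - KB 0 0 i j) - (KA σ 0 i j - KA 0 0 i j)‖
        ≤ r * (B' * Real.exp (-(ρ * distX X (locp i) (locn j))))) :
    ∀ ω, ∀ σ : TPt d N' → ℂ, (∀ j, ‖σ j‖ ≤ Real.exp c.κ₁) → ∀ u ∈ ball (0 : E) R,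
      ∀ i j, ‖twoTerms KB ω σ u i j - twoTerms KA ω σ u i j‖
        ≤ r * (ampl B B' ω * Real.exp (-(ρ * walkDist X ω (locp i) (locn j)))) := by
  intro ω σ hσ u hu i j
  have hR : 0 < R := lt_of_le_of_lt dist_nonneg (mem_ball.1 hu)
  have h0 : (0 : E) ∈ ball (0 : E) R := mem_ball_self hR
  have hz : ∀ j, ‖(0 : TPt d N' → ℂ) j‖ ≤ Real.exp c.κ₁ := fun _ => by simpa using (Real.exp_pos c.κ₁).le
  cases ω
  · simp only [twoTerms_false, Matrix.add_apply, Matrix.sub_apply, ampl_false, walkDist_false]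
    have h1 := hclose σ hσ u hu i j
    have h2 := hclose σ hσ 0 h0 i j
    have h3 := hclose 0 hz 0 h0 i j
    have halg : KB σ u i j - KB σ 0 i j + KB 0 0 i j - (KA σ u i j - KA σ 0 i j + KA 0 0 i j)
        = (KB σ u i j - KA σ u i j) - (KB σ 0 i j - KA σ 0 i j) + (KB 0 0 i j - KA 0 0 i j) := by ring
    rw [halg]
    calc ‖(KB σ u i j - KA σ u i j) - (KB σ 0 i j - KA σ 0 i j) + (KB 0 0 i j - KA 0 0 i j)‖
        ≤ ‖KB σ u i j - KA σ u i j‖ + ‖KB σ 0 i j - KA σ 0 i j‖ + ‖KB 0 0 i j - KA 0 0 i j‖ :=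
          (norm_add_le _ _).trans (add_le_add (norm_sub_le _ _) le_rfl)
      _ ≤ 3 * (r * (B * Real.exp (-(ρ * tdist1 Nf (locp i) (locn j))))) := by linarith
      _ = r * (3 * B * Real.exp (-(ρ * tdist1 Nf (locp i) (locn j)))) := by ring
  · simp only [twoTerms_true, Matrix.sub_apply, ampl_true, walkDist_true]
    exact hlocClose σ hσ i j

end Letters

/-- **The two-term walk distances dominate the torus distance** (`walkDist X false = d₁`, `walkDist X true = d_X ≥ d₁`,
`X ≠ ∅`) — file 4's binder `hEdom`. [cite: Balaban1985BackgroundPropagators, (3.93) p.410] -/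
theorem domBy_walkDist {X : Finset (UT Nf)} (hX : X.Nonempty) :
    ∀ ω, DomBy (toB6 (torusGeom Nf 0 0 0) 0 True) (walkDist X ω) := by
  intro ω y y'
  rw [toB6_dist, dist_torusGeom]
  cases ω
  · exact le_rfl
  · exact tdist1_le_distX hX y y'

/-- The torus distance dominates itself — file 4's binder `hCdom` for the one-term covariance family. [folklore] -/
theorem domBy_tdist1 : DomBy (toB6 (torusGeom Nf 0 0 0) 0 True) (tdist1 Nf) := by
  intro y y'
  rw [toB6_dist, dist_torusGeom]

/-- **The one-term covariance family's partial sums** (`W = Unit`, amplitude `B_C`, rate `r_C`): `MajSumLe` against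
`B_C·e^{−κ_C d₁}` for `κ_C ≤ r_C` — file 4's binder `hCms` for the family of `NodeOLetters.walkMajorants_of_decay`. [folklore] -/
theorem majSumLe_single {BC rC κC : ℝ} (hBC : 0 ≤ BC) (hκ : κC ≤ rC) :
    MajSumLe (g := toB6 (torusGeom Nf 0 0 0) 0 True) (fun (_ : Unit) a b => BC * Real.exp (-(rC * tdist1 Nf a b)))
      (fun a b => BC * Real.exp (-(κC * tdist1 Nf a b))) := by
  intro S a b
  have hd : 0 ≤ tdist1 Nf a b := tdist1_nonneg a b
  calc ∑ _ω ∈ S, BC * Real.exp (-(rC * tdist1 Nf a b))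
      ≤ ∑ _ω : Unit, BC * Real.exp (-(rC * tdist1 Nf a b)) :=
        Finset.sum_le_sum_of_subset_of_nonneg (Finset.subset_univ S) fun _ _ _ => by positivity
    _ = BC * Real.exp (-(rC * tdist1 Nf a b)) := by
        rw [Finset.sum_const, Finset.card_univ, Fintype.card_unit, one_nsmul]
    _ ≤ BC * Real.exp (-(κC * tdist1 Nf a b)) :=
        mul_le_mul_of_nonneg_left (Real.exp_le_exp.mpr (by nlinarith)) hBC

/-! ## §2 The END's record binder at a window scale FROM NODE O's letters for the two runs -/

variable {c : B13.Consts}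

/-- **THE END'S RECORD BINDER FROM NODE O'S LETTER INTERFACE FOR THE TWO RUNS, UNDER THE RATE (per term, at a window scale).**
A record `𝒦` whose Γ-kernel and precision ARE the diagonal pencils of run A's and run B's families (`hG2`, `hA2`); for each
slot, NODE O's LETTERS (L1)–(L3) for BOTH runs with common constants (`KernelLetters … R (κ+ε) B B′`) and the TWO-RUN
CLOSENESS LETTERS — (C1) entrywise `r`-closeness on polydisc × ball, (C2) `r`-closeness of the σ-localised pieces through
`𝒦.X`; run A's (L4) (plain decay of `(AA σ u)⁻¹` at rate `ρ_C`) and (C3) invertibility `AA(AA)⁻¹ = 1`; the geometric clause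
(L5); T42's numeric side conditions VERBATIM with `K̄_E = 3B_E + B′_E`, `K̄_C = B_C`; rows NE2∕NE3's rate `r ≤ C₂θ^j`, the
window condition `θ^j < s∕(2C₂C_R)`, and the END's package equations with letters `(1+s)(3B_Γ + B′_Γ)`, `(1+s)(3B_E + B′_E)`,
`B_C(1−q)⁻¹` ⟹ `TermWalkData 𝒦 wj`.  Proof: `N18TwoRunRecord.termWalkData_of_twoRuns_at_window` with every walk-level
binder supplied BY NAME — `NodeOLetters.jointWalkExpansion_of_letters` (both slots, both runs), §1.
[cite: Balaban1988RG2Cluster, (1.5) p.3, (1.11) p.5, p.13, p.15, (2.16) p.16; Balaban1985BackgroundPropagators, (3.93) p.410, Thm 3.10 p.416, (3.130) p.421; King1986, p.665] -/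
theorem termWalkData_of_twoRunLetters_at_window (𝒦 : TermKernels c d N' ν Nf ℂ) (hX : 𝒦.X.Nonempty)
    {GA GB : (TPt d N' → ℂ) → ℂ → Matrix 𝒦.Λ (𝒦.Λ ⊕ 𝒦.C₀) ℂ} {AA AB : (TPt d N' → ℂ) → ℂ → Matrix 𝒦.Λ 𝒦.Λ ℂ}
    (hG2 : ∀ σ b, 𝒦.G2 σ b = GA σ b + b • (GB σ b - GA σ b))
    (hA2 : ∀ σ b, 𝒦.A2 σ b = AA σ b + b • (AB σ b - AA σ b))
    -- (Γ) NODE O's letters (L1)–(L3) for both runs' Γ-kernels, and the two-run closeness letters (C1), (C2)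
    {R r s BΓ BΓ' εΓ kapΓ : ℝ}
    (hLΓA : KernelLetters c 𝒦.locΛ 𝒦.locN GA 𝒦.X R (kapΓ + εΓ) BΓ BΓ')
    (hLΓB : KernelLetters c 𝒦.locΛ 𝒦.locN GB 𝒦.X R (kapΓ + εΓ) BΓ BΓ') (hkapΓ : 0 ≤ kapΓ)
    (hcloseΓ : ∀ σ : TPt d N' → ℂ, (∀ j, ‖σ j‖ ≤ Real.exp c.κ₁) → ∀ u ∈ ball (0 : ℂ) R,
      ∀ i j, ‖GB σ u i j - GA σ u i j‖ ≤ r * (BΓ * Real.exp (-((kapΓ + εΓ) * tdist1 Nf (𝒦.locΛ i) (𝒦.locN j)))))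
    (hlocΓ : ∀ σ : TPt d N' → ℂ, (∀ j, ‖σ j‖ ≤ Real.exp c.κ₁) →
      ∀ i j, ‖(GB σ 0 i j - GB 0 0 i j) - (GA σ 0 i j - GA 0 0 i j)‖
        ≤ r * (BΓ' * Real.exp (-((kapΓ + εΓ) * distX 𝒦.X (𝒦.locΛ i) (𝒦.locN j)))))
    -- (E) the same for the precisions
    {BE BE' εE kapE : ℝ}
    (hLEA : KernelLetters c 𝒦.locΛ 𝒦.locΛ AA 𝒦.X R (kapE + εE) BE BE')
    (hLEB : KernelLetters c 𝒦.locΛ 𝒦.locΛ AB 𝒦.X R (kapE + εE) BE BE') (hkapE : 0 ≤ kapE)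
    (hcloseE : ∀ σ : TPt d N' → ℂ, (∀ j, ‖σ j‖ ≤ Real.exp c.κ₁) → ∀ u ∈ ball (0 : ℂ) R,
      ∀ i j, ‖AB σ u i j - AA σ u i j‖ ≤ r * (BE * Real.exp (-((kapE + εE) * tdist1 Nf (𝒦.locΛ i) (𝒦.locΛ j)))))
    (hlocE : ∀ σ : TPt d N' → ℂ, (∀ j, ‖σ j‖ ≤ Real.exp c.κ₁) →
      ∀ i j, ‖(AB σ 0 i j - AB 0 0 i j) - (AA σ 0 i j - AA 0 0 i j)‖
        ≤ r * (BE' * Real.exp (-((kapE + εE) * distX 𝒦.X (𝒦.locΛ i) (𝒦.locΛ j)))))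
    -- (C) run A's inverse precision: NODE O's letter (L4) and invertibility (C3)
    {BC ρC : ℝ} (hBC : 0 ≤ BC)
    (hC4 : ∀ σ : TPt d N' → ℂ, (∀ j, ‖σ j‖ ≤ Real.exp c.κ₁) → ∀ u ∈ ball (0 : ℂ) R,
      ∀ i k, ‖(AA σ u)⁻¹ i k‖ ≤ BC * Real.exp (-(ρC * tdist1 Nf (𝒦.locΛ i) (𝒦.locΛ k))))
    (hAC : ∀ σ : TPt d N' → ℂ, (∀ j, ‖σ j‖ ≤ Real.exp c.κ₁) → ∀ u ∈ ball (0 : ℂ) R, AA σ u * (AA σ u)⁻¹ = 1)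
    -- T42's numeric side conditions (row sums, rate windows, fibre bound, Neumann smallness in the reach `s`)
    {rC κC ρ ρs σ₁ c₁ σ' c' κs κ : ℝ} {m : ℕ}
    (hfib : ∀ y : UT Nf, (Finset.univ.filter fun k => 𝒦.locΛ k = y).card ≤ m)
    (hrow : RowSum (toB6 (torusGeom Nf 0 0 0) 0 True) σ₁ c₁) (hrow' : RowSum (toB6 (torusGeom Nf 0 0 0) 0 True) σ' c')
    (hσ₁ : 0 ≤ σ₁) (hσ' : 0 ≤ σ') (hc₁ : 0 ≤ c₁) (hc' : 0 ≤ c')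
    (hρ : 0 ≤ ρ) (hρs : ρ + σ₁ ≤ ρs) (hρsC : ρs ≤ ρC) (hρsE : ρs + σ₁ ≤ kapE + εE) (hrC : rC ≤ ρ) (hκrC : κC ≤ rC)
    (hrE : kapE + εE - εE ≤ ρ)
    (hκs : 0 ≤ κs) (hκsE : κs ≤ kapE) (hκsC : κs + σ' ≤ κC) (hκ : 0 ≤ κ) (hκC : κ ≤ κC) (hκκs : κ + σ' ≤ κs)
    (hq : (m * c₁) * ((m * c₁) * BC * (s * (3 * BE + BE')) * c') * c' < 1)
    {Rσ : ℝ} (hfar : ∀ b : 𝒦.Λ, ∀ z ∈ 𝒦.X, Rσ ≤ tdist1 Nf (𝒦.locΛ b) z)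
    {ε' kap' : ℝ} (hε'Γ : ε' ≤ εΓ) (hε'E : ε' ≤ εE) (hkap'Γ : kap' ≤ kapΓ) (hkap'E : kap' ≤ kapE) (hkap'κ : kap' ≤ κ)
    -- rows NE2∕NE3's RATE for the closeness letters, and the END's package at this (window) scale
    (wj : WalkConsts) {θ C₂ CR : ℝ} {j : ℕ} (hθ : 0 < θ) (hs : 0 < s) (hC₂ : 0 < C₂) (hCR : 0 < CR) (hr : 0 < r)
    (hrate : r ≤ C₂ * θ ^ j) (hj : θ ^ j < s / (2 * C₂ * CR))
    (hR : wj.R = max 2 (s / (2 * C₂ * CR) / θ ^ j) * CR) (hRA : wj.R ≤ R)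
    (hwε : wj.ε = ε') (hwkap : wj.kap = kap') (hwΓ : wj.KbarΓ = (1 + s) * (3 * BΓ + BΓ'))
    (hwE : wj.KbarE = (1 + s) * (3 * BE + BE')) (hwC : wj.KbarC = BC * (1 - (m * c₁) * ((m * c₁) * BC * (s * (3 * BE + BE')) * c') * c')⁻¹)
    (hwσ : wj.Rσ = Rσ) :
    TermWalkData 𝒦 wj := by
  have hKΓ0 : 0 ≤ 3 * BΓ + BΓ' := by linarith [hLΓA.B_nonneg, hLΓA.B'_nonneg]
  have hKE0 : 0 ≤ 3 * BE + BE' := by linarith [hLEA.B_nonneg, hLEA.B'_nonneg]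
  exact termWalkData_of_twoRuns_at_window 𝒦 hG2 hA2
    (jointWalkExpansion_of_letters hX hLΓA hkapΓ) (jointWalkExpansion_of_letters hX hLΓB hkapΓ) le_rfl
    (termwise_close_of_letters hcloseΓ hlocΓ)
    (jointWalkExpansion_of_letters hX hLEA hkapE) (jointWalkExpansion_of_letters hX hLEB hkapE) le_rfl
    (termwise_close_of_letters hcloseE hlocE) (domBy_walkDist hX)
    (TC := fun (_ : Unit) σ u => (AA σ u)⁻¹) (Cm := fun σ u => (AA σ u)⁻¹) (AC := fun _ => BC)
    (DC := fun _ a b => tdist1 Nf a b)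
    (fun σ₀ _ u _ i k => hasSum_unique fun _ : Unit => (AA σ₀ u)⁻¹ i k)
    (fun _ σ₀ hσ u hu i k => hC4 σ₀ hσ u hu i k)
    (majSumLe_single hBC hκrC) (fun _ => domBy_tdist1) (fun _ => hBC) hAC
    hfib hrow hrow' hσ₁ hσ' hc₁ hc' hρ hρs hρsC hρsE hrC hrE hBC hKΓ0 hKE0 hκs hκsE hκsC hκ hκC hκκs hq hfar
    hε'Γ hε'E hkap'Γ hkap'E hkap'κ wj hθ hs hC₂ hCR hr hrate hj hR hRA hwε hwkap hwΓ hwE hwC hwσ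

/-! ## §3 (v1.1) STATIC run kernels: the pencil-radius demand on the RUNS is vacuous -/

section Static

variable {p n : Type} {E : Type*} [NormedAddCommGroup E] [NormedSpace ℂ E] {c : B13.Consts}

/-- **NODE O's letters for a STATIC kernel family at EVERY radius.**  In the intended instancing of §2 the u-slot of the END's
record is the PENCIL parameter, so each run's own kernel does not depend on it: `GA σ u := K_A σ`.  For such a family the
ball radius `R` in `KernelLetters` is idle — σ-only letters (L1) `‖K(σ)_{ij}‖ ≤ B e^{−ρ d₁(i,j)}` on the polydisc and (L2)
`‖(K(σ) − K(0))_{ij}‖ ≤ B′ e^{−ρ d_X(i,j)}` give `KernelLetters c locp locn (fun σ _ => K σ) X R ρ B B′` for EVERY `R`, (L3)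
being `differentiableOn_const`.  Hence §2's demand that both runs' letters hold on the pencil ball of radius `wj.R ≥ 2`
(growing like `s∕θ^j`) is VACUOUS for static runs: only the closeness letters (C1)∕(C2) and run A's (L4) carry content,
and (C1) reads `‖K_B(σ) − K_A(σ)‖ ≤ r·B·e^{−ρ d₁}` — rows NE2∕NE3's primitive two-run rate in walk-free form.
[cite: Balaban1988RG2Cluster, (1.11) p.5, p.13, (2.16) p.16; King1986, p.665] -/
theorem kernelLetters_of_static {locp : p → UT Nf} {locn : n → UT Nf} {K : (TPt d N' → ℂ) → Matrix p n ℂ}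
    {X : Finset (UT Nf)} {ρ B B' : ℝ} (R : ℝ) (hB : 0 ≤ B) (hB' : 0 ≤ B')
    (hdecay : ∀ σ : TPt d N' → ℂ, (∀ j, ‖σ j‖ ≤ Real.exp c.κ₁) →
      ∀ i j, ‖K σ i j‖ ≤ B * Real.exp (-(ρ * tdist1 Nf (locp i) (locn j))))
    (hloc : ∀ σ : TPt d N' → ℂ, (∀ j, ‖σ j‖ ≤ Real.exp c.κ₁) →
      ∀ i j, ‖K σ i j - K 0 i j‖ ≤ B' * Real.exp (-(ρ * distX X (locp i) (locn j)))) :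
    KernelLetters c locp locn (fun σ (_ : E) => K σ) X R ρ B B' where
  decay σ hσ _ _ i j := hdecay σ hσ i j
  sigmaLoc σ hσ i j := hloc σ hσ i j
  holo _ _ _ _ := differentiableOn_const _
  B_nonneg := hB
  B'_nonneg := hB'

omit [NormedSpace ℂ E] in
/-- For STATIC runs the two-run closeness letter (C1) of §1∕§2 is the σ-only entrywise rate
`‖(K_B(σ) − K_A(σ))_{ij}‖ ≤ r·B·e^{−ρ d₁(i,j)}` read at every `u` (bookkeeping). [cite: King1986, p.665] -/
theorem close_of_static {locp : p → UT Nf} {locn : n → UT Nf} {KA KB : (TPt d N' → ℂ) → Matrix p n ℂ}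
    {R ρ B r : ℝ}
    (h : ∀ σ : TPt d N' → ℂ, (∀ j, ‖σ j‖ ≤ Real.exp c.κ₁) →
      ∀ i j, ‖KB σ i j - KA σ i j‖ ≤ r * (B * Real.exp (-(ρ * tdist1 Nf (locp i) (locn j))))) :
    ∀ σ : TPt d N' → ℂ, (∀ j, ‖σ j‖ ≤ Real.exp c.κ₁) → ∀ u ∈ ball (0 : E) R,
      ∀ i j, ‖(fun σ (_ : E) => KB σ) σ u i j - (fun σ (_ : E) => KA σ) σ u i j‖
        ≤ r * (B * Real.exp (-(ρ * tdist1 Nf (locp i) (locn j)))) :=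
  fun σ hσ _ _ i j => h σ hσ i j

end Static

/-! ## §4 (v1.2) The END's record binder at a window scale from σ-only letters for STATIC two-run families -/

/-- **THE END'S RECORD BINDER FROM NODE O'S σ-ONLY LETTERS FOR STATIC TWO-RUN FAMILIES (per term, at a window scale).**
§2 `termWalkData_of_twoRunLetters_at_window` for STATIC run kernels (§3) — the record's Γ-kernel and precision are
the pencils `𝒦.G2 σ z = K_A σ + z•(K_B σ − K_A σ)`, `𝒦.A2 σ z = A_A σ + z•(A_B σ − A_A σ)`; per slot the σ-only letters (L1)
plain decay, (L2) σ-localisation through `𝒦.X` for both runs, and the TWO-RUN closeness letters (C1) entrywise, (C2) for the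
σ-localised pieces, at rate `ϱ`; run A's (L4) and (C3) `A_A(A_A)⁻¹ = 1`; (L5) at `wj.Rσ`; T42's numerics (fibre bound from the
record field `𝒦.hfib` and `𝒦.m ≤ m`); `ϱ ≤ C₂θ^j`; the window `θ^j < s∕(2C₂C_R)`; the END's package equations ⟹ `TermWalkData 𝒦 wj`.
Static families carry NODE O's letters at EVERY ball radius (`kernelLetters_of_static`): the radius is taken `:= wj.R`.
[cite: Balaban1988RG2Cluster, (1.5) p.3, (1.11) p.5, p.13, p.15, (2.16) p.16; Balaban1985BackgroundPropagators, (3.93) p.410, Thm 3.10 p.416, (3.130) p.421; King1986, p.665] -/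
theorem termWalkData_of_staticLetters_at_window (𝒦 : TermKernels c d N' ν Nf ℂ) (hX : 𝒦.X.Nonempty)
    {KA KB : (TPt d N' → ℂ) → Matrix 𝒦.Λ (𝒦.Λ ⊕ 𝒦.C₀) ℂ} {AA AB : (TPt d N' → ℂ) → Matrix 𝒦.Λ 𝒦.Λ ℂ}
    (hG2 : ∀ σ z, 𝒦.G2 σ z = KA σ + z • (KB σ - KA σ))
    (hA2 : ∀ σ z, 𝒦.A2 σ z = AA σ + z • (AB σ - AA σ))
    -- (Γ) σ-only letters (L1)(L2) for both runs' Γ-kernels, and the two-run closeness letters (C1), (C2) at rate `ϱ`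
    {ϱ s BΓ BΓ' εΓ kapΓ : ℝ} (hBΓ : 0 ≤ BΓ) (hBΓ' : 0 ≤ BΓ') (hkapΓ : 0 ≤ kapΓ)
    (hΓA : ∀ σ : TPt d N' → ℂ, (∀ j, ‖σ j‖ ≤ Real.exp c.κ₁) →
      ∀ i j, ‖KA σ i j‖ ≤ BΓ * Real.exp (-((kapΓ + εΓ) * tdist1 Nf (𝒦.locΛ i) (𝒦.locN j))))
    (hΓA' : ∀ σ : TPt d N' → ℂ, (∀ j, ‖σ j‖ ≤ Real.exp c.κ₁) →
      ∀ i j, ‖KA σ i j - KA 0 i j‖ ≤ BΓ' * Real.exp (-((kapΓ + εΓ) * distX 𝒦.X (𝒦.locΛ i) (𝒦.locN j))))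
    (hΓB : ∀ σ : TPt d N' → ℂ, (∀ j, ‖σ j‖ ≤ Real.exp c.κ₁) →
      ∀ i j, ‖KB σ i j‖ ≤ BΓ * Real.exp (-((kapΓ + εΓ) * tdist1 Nf (𝒦.locΛ i) (𝒦.locN j))))
    (hΓB' : ∀ σ : TPt d N' → ℂ, (∀ j, ‖σ j‖ ≤ Real.exp c.κ₁) →
      ∀ i j, ‖KB σ i j - KB 0 i j‖ ≤ BΓ' * Real.exp (-((kapΓ + εΓ) * distX 𝒦.X (𝒦.locΛ i) (𝒦.locN j))))
    (hcloseΓ : ∀ σ : TPt d N' → ℂ, (∀ j, ‖σ j‖ ≤ Real.exp c.κ₁) →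
      ∀ i j, ‖KB σ i j - KA σ i j‖ ≤ ϱ * (BΓ * Real.exp (-((kapΓ + εΓ) * tdist1 Nf (𝒦.locΛ i) (𝒦.locN j)))))
    (hlocΓ : ∀ σ : TPt d N' → ℂ, (∀ j, ‖σ j‖ ≤ Real.exp c.κ₁) →
      ∀ i j, ‖(KB σ i j - KB 0 i j) - (KA σ i j - KA 0 i j)‖
        ≤ ϱ * (BΓ' * Real.exp (-((kapΓ + εΓ) * distX 𝒦.X (𝒦.locΛ i) (𝒦.locN j)))))
    -- (E) the same for the precisions
    {BE BE' εE kapE : ℝ} (hBE : 0 ≤ BE) (hBE' : 0 ≤ BE') (hkapE : 0 ≤ kapE)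
    (hEA : ∀ σ : TPt d N' → ℂ, (∀ j, ‖σ j‖ ≤ Real.exp c.κ₁) →
      ∀ i j, ‖AA σ i j‖ ≤ BE * Real.exp (-((kapE + εE) * tdist1 Nf (𝒦.locΛ i) (𝒦.locΛ j))))
    (hEA' : ∀ σ : TPt d N' → ℂ, (∀ j, ‖σ j‖ ≤ Real.exp c.κ₁) →
      ∀ i j, ‖AA σ i j - AA 0 i j‖ ≤ BE' * Real.exp (-((kapE + εE) * distX 𝒦.X (𝒦.locΛ i) (𝒦.locΛ j))))
    (hEB : ∀ σ : TPt d N' → ℂ, (∀ j, ‖σ j‖ ≤ Real.exp c.κ₁) →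
      ∀ i j, ‖AB σ i j‖ ≤ BE * Real.exp (-((kapE + εE) * tdist1 Nf (𝒦.locΛ i) (𝒦.locΛ j))))
    (hEB' : ∀ σ : TPt d N' → ℂ, (∀ j, ‖σ j‖ ≤ Real.exp c.κ₁) →
      ∀ i j, ‖AB σ i j - AB 0 i j‖ ≤ BE' * Real.exp (-((kapE + εE) * distX 𝒦.X (𝒦.locΛ i) (𝒦.locΛ j))))
    (hcloseE : ∀ σ : TPt d N' → ℂ, (∀ j, ‖σ j‖ ≤ Real.exp c.κ₁) →
      ∀ i j, ‖AB σ i j - AA σ i j‖ ≤ ϱ * (BE * Real.exp (-((kapE + εE) * tdist1 Nf (𝒦.locΛ i) (𝒦.locΛ j)))))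
    (hlocE : ∀ σ : TPt d N' → ℂ, (∀ j, ‖σ j‖ ≤ Real.exp c.κ₁) →
      ∀ i j, ‖(AB σ i j - AB 0 i j) - (AA σ i j - AA 0 i j)‖
        ≤ ϱ * (BE' * Real.exp (-((kapE + εE) * distX 𝒦.X (𝒦.locΛ i) (𝒦.locΛ j)))))
    -- (C) run A's inverse precision: NODE O's letter (L4) and invertibility (C3)
    {BC ρC : ℝ} (hBC : 0 ≤ BC)
    (hC4 : ∀ σ : TPt d N' → ℂ, (∀ j, ‖σ j‖ ≤ Real.exp c.κ₁) →
      ∀ i k, ‖(AA σ)⁻¹ i k‖ ≤ BC * Real.exp (-(ρC * tdist1 Nf (𝒦.locΛ i) (𝒦.locΛ k))))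
    (hAC : ∀ σ : TPt d N' → ℂ, (∀ j, ‖σ j‖ ≤ Real.exp c.κ₁) → AA σ * (AA σ)⁻¹ = 1)
    -- T42's numeric side conditions (row sums, rate windows, fibre bound, Neumann smallness in the reach `s`)
    {rC κC ρ ρs σ₁ c₁ σ' c' κs κ : ℝ} {m : ℕ} (hm : 𝒦.m ≤ m)
    (hrow : RowSum (toB6 (torusGeom Nf 0 0 0) 0 True) σ₁ c₁) (hrow' : RowSum (toB6 (torusGeom Nf 0 0 0) 0 True) σ' c')
    (hσ₁ : 0 ≤ σ₁) (hσ' : 0 ≤ σ') (hc₁ : 0 ≤ c₁) (hc' : 0 ≤ c')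
    (hρ : 0 ≤ ρ) (hρs : ρ + σ₁ ≤ ρs) (hρsC : ρs ≤ ρC) (hρsE : ρs + σ₁ ≤ kapE + εE) (hrC : rC ≤ ρ) (hκrC : κC ≤ rC)
    (hrE : kapE ≤ ρ)
    (hκs : 0 ≤ κs) (hκsE : κs ≤ kapE) (hκsC : κs + σ' ≤ κC) (hκ : 0 ≤ κ) (hκC : κ ≤ κC) (hκκs : κ + σ' ≤ κs)
    (hq : (m * c₁) * ((m * c₁) * BC * (s * (3 * BE + BE')) * c') * c' < 1)
    {ε' kap' : ℝ} (hε'Γ : ε' ≤ εΓ) (hε'E : ε' ≤ εE) (hkap'Γ : kap' ≤ kapΓ) (hkap'E : kap' ≤ kapE) (hkap'κ : kap' ≤ κ)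
    -- rows NE2∕NE3's RATE for the closeness letters, and the END's package at this (window) scale
    (wj : WalkConsts) {θ C₂ CR : ℝ} {j : ℕ} (hθ : 0 < θ) (hs : 0 < s) (hC₂ : 0 < C₂) (hCR : 0 < CR) (hϱ : 0 < ϱ)
    (hrate : ϱ ≤ C₂ * θ ^ j) (hj : θ ^ j < s / (2 * C₂ * CR))
    (hR : wj.R = max 2 (s / (2 * C₂ * CR) / θ ^ j) * CR)
    (hwε : wj.ε = ε') (hwkap : wj.kap = kap') (hwΓ : wj.KbarΓ = (1 + s) * (3 * BΓ + BΓ'))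
    (hwE : wj.KbarE = (1 + s) * (3 * BE + BE'))
    (hwC : wj.KbarC = BC * (1 - (m * c₁) * ((m * c₁) * BC * (s * (3 * BE + BE')) * c') * c')⁻¹)
    -- (L5) the geometric clause at the package's σ-distance
    (hfar : ∀ b : 𝒦.Λ, ∀ z ∈ 𝒦.X, wj.Rσ ≤ tdist1 Nf (𝒦.locΛ b) z) :
    TermWalkData 𝒦 wj :=
  termWalkData_of_twoRunLetters_at_window 𝒦 hX (GA := fun σ (_ : ℂ) => KA σ) (GB := fun σ (_ : ℂ) => KB σ)
    (AA := fun σ (_ : ℂ) => AA σ) (AB := fun σ (_ : ℂ) => AB σ) hG2 hA2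
    (kernelLetters_of_static wj.R hBΓ hBΓ' hΓA hΓA') (kernelLetters_of_static wj.R hBΓ hBΓ' hΓB hΓB') hkapΓ
    (close_of_static hcloseΓ) hlocΓ
    (kernelLetters_of_static wj.R hBE hBE' hEA hEA') (kernelLetters_of_static wj.R hBE hBE' hEB hEB') hkapE
    (close_of_static hcloseE) hlocE hBC (fun σ hσ _ _ i k => hC4 σ hσ i k) (fun σ hσ _ _ => hAC σ hσ)
    (fun y => (𝒦.hfib y).trans hm) hrow hrow' hσ₁ hσ' hc₁ hc' hρ hρs hρsC hρsE hrC hκrC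
    (by rw [add_sub_cancel_right]; exact hrE) hκs hκsE hκsC hκ hκC hκκs hq hfar hε'Γ hε'E hkap'Γ hkap'E hkap'κ
    wj hθ hs hC₂ hCR hϱ hrate hj hR le_rfl hwε hwkap hwΓ hwE hwC rfl

end Summit.QuantumFields.YangMills.BalabanUVNodes.N18TwoRunLetters

end
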